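import Summits.ValiantsHypothesis.ValiantsHypothesis.Theorems.LangWeilTransferTameResolutionVRhoSizes
import Summits.ValiantsHypothesis.ValiantsHypothesis.Theorems.LangWeilTransferTameResolutionFactorSizes
import Summits.ValiantsHypothesis.ValiantsHypothesis.Theorems.LangWeilTransferTameResolutionBezoutExplicit

/-!
# LangWeilTransfer, support item `TameResolution` (stmt-ValiantsHypothesis-6378) — sizes of the
# hypersurface model `Q` (the last link of the size chain before the Noether data)

Route `LangWeilTransfer` of `ValiantsHypothesis` (conditional route; honest framing: bookkeeping,
nothing here bears on VP ≠ VNP). Quantitative pass (roadmap note of val-lit-p6 g9, §4 (S)), for the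
data of `exists_parametrisation_explicit`: the fibre `q_c = q.map sp_c` is non-zero (because
`ρ = sp_c Res ≠ 0` and `Res = q A + q' B`), its coefficients are specialisations of those of `q`
(`rho_sizes`), so the factor `Q ∣ q_c` is bounded by `factor_sizes` over `ℤ[T][U]`, and the packaged
`(finSuccEquiv ℤ r)⁻¹ Q` by `LangWeilTransferTameResolutionFlatSizes`.

* `map_specC_ne_zero` — `q_c ≠ 0`;
* `Q_sizes` — `deg_U Q ≤ N`, total degree and weight of `(finSuccEquiv ℤ r)⁻¹ Q`.
-/

noncomputable section

open MvPolynomial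
open Literature.Computability.AlgebraicComplexity

-- the summit and the problem share the name `ValiantsHypothesis` (D-0017 single-conjunct layout)
set_option linter.dupNamespace false

namespace Summit.ValiantsHypothesis.ValiantsHypothesis.Theorems.LangWeilTransfer

variable {r n : ℕ}

/-- **The fibre `q_c` is non-zero** as soon as `ρ = sp_c Res(q, q') ≠ 0`. -/
theorem map_specC_ne_zero (q : Polynomial (MvPolynomial (Fin n) (MvPolynomial (Fin r) ℤ)))
    (hq : 0 < q.natDegree) (sp : MvPolynomial (Fin n) (MvPolynomial (Fin r) ℤ) →+* MvPolynomial (Fin r) ℤ)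
    (hρ : sp (Polynomial.resultant q (Polynomial.derivative q) q.natDegree (Polynomial.derivative q).natDegree) ≠ 0) :
    q.map sp ≠ 0 := by
  intro h0
  obtain ⟨A, B, -, -, hbez, -, -⟩ := exists_bezout_explicit q (Polynomial.derivative q) le_rfl le_rfl
    (Or.inl (by omega))
  have h := congrArg (Polynomial.map sp) hbez
  rw [Polynomial.map_add, Polynomial.map_mul, Polynomial.map_mul, ← Polynomial.derivative_map, h0,
    Polynomial.derivative_zero, zero_mul, zero_mul, zero_add, Polynomial.map_C] at h
  have h' := congrArg (fun P => P.coeff 0) h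
  simp only [Polynomial.coeff_zero, Polynomial.coeff_C_zero] at h'
  exact hρ h'.symm

/-- **Sizes of `Q`.** With `deg_U q ≤ N`, flattened coefficients of `q` of degree `≤ D'` and weight
`≤ W'`, `c ≤ N_c` (`1 ≤ N_c`), `Q ∣ q_c ≠ 0`: `deg_U Q ≤ N`, and `(finSuccEquiv ℤ r)⁻¹ Q` has total
degree `≤ D' + 2N` and weight `≤ (N+1)² W' N_c^{D'} ((D'+N+1)(2(D'+N)+1)^{2(D'+N)})^{r+1}`. -/
theorem Q_sizes (c : Fin n → ℕ) {Nc N D' W' : ℕ} (hNc : 1 ≤ Nc) (hc : ∀ j, c j ≤ Nc)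
    (q : Polynomial (MvPolynomial (Fin n) (MvPolynomial (Fin r) ℤ))) (Q : Polynomial (MvPolynomial (Fin r) ℤ))
    (hqN : q.natDegree ≤ N)
    (hqD : ∀ i, (rename finSumFinEquiv ((sumAlgEquiv ℤ (Fin n) (Fin r)).symm (q.coeff i))).totalDegree ≤ D')
    (hqW : ∀ i, weight (rename finSumFinEquiv ((sumAlgEquiv ℤ (Fin n) (Fin r)).symm (q.coeff i))) ≤ W') :
    let sp : MvPolynomial (Fin n) (MvPolynomial (Fin r) ℤ) →+* MvPolynomial (Fin r) ℤ :=
      eval fun j => ((c j : ℕ) : MvPolynomial (Fin r) ℤ)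
    q.map sp ≠ 0 → Q ∣ q.map sp →
    Q.natDegree ≤ N ∧
    ((finSuccEquiv ℤ r).symm Q).totalDegree ≤ (D' + N) + N ∧
    weight ((finSuccEquiv ℤ r).symm Q) ≤
      (N + 1) * ((N + 1) * (W' * Nc ^ D') * (((D' + N) + 1) * (2 * (D' + N) + 1) ^ (2 * (D' + N))) ^ (r + 1)) := by
  intro sp h0 hQ
  -- coefficients of `q_c`
  have hcoef : ∀ i, ((q.map sp).coeff i).totalDegree ≤ D' ∧ weight ((q.map sp).coeff i) ≤ W' * Nc ^ D' := by
    intro i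
    rw [Polynomial.coeff_map]
    have h := rho_sizes (r := r) c hNc hc (q.coeff i) (hqD i) (hqW i)
    simp only at h
    exact h
  have hPN : (q.map sp).natDegree ≤ N := (Polynomial.natDegree_map_le).trans hqN
  obtain ⟨h1, h2, h3⟩ := factor_sizes (q.map sp) Q h0 hQ hPN (fun i => (hcoef i).1) (fun i => (hcoef i).2)
  refine ⟨h1, totalDegree_finSuccEquiv_symm_le Q h1 h2, ?_⟩
  exact weight_finSuccEquiv_symm_le Q h1 h3

end Summit.ValiantsHypothesis.ValiantsHypothesis.Theorems.LangWeilTransfer
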